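import Literature.AlgebraicGeometry.Motives.AbelianVarietyCotangentHom
import Literature.AlgebraicGeometry.Motives.AbelianVarietyCotangentBaseChangeIso
import HarnessLib

/-!
# Base change of the cotangent map of a homomorphism of abelian varieties

Let `f : A → B` be a homomorphism of abelian varieties over a field `K` and `L ⊇ K` a field
extension. The base-change isomorphisms of the cotangent spaces at the origins,
`L ⊗_K T_e^*(A) ≃ T_e^*(A_L)` and `L ⊗_K T_e^*(B) ≃ T_e^*(B_L)`
(`AbelianVariety.cotangentBaseChange`, Görtz–Wedhorn I, Remark 6.12 (2)–(3): for a `k`-rational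
point `x` and `x'` over it in `X ⊗_k k'`, `T_{x'}(X ⊗_k k') = T_x(X) ⊗_k k'`), intertwine the
cotangent map `f^* : T_e^*(B) → T_e^*(A)` of `f` (`AbelianVariety.Hom.cotangentMap`,
`Motives/AbelianVarietyCotangentHom`) with that of its base change `f_L : A_L → B_L`:

* `AbelianVariety.stalkMapFst_comp_stalkMapOrigin_baseChange` — on local rings at the origins,
  `(f_L)^* ∘ pr_B^* = pr_A^* ∘ f^*` (from `f_L ≫ pr_B = pr_A ≫ f`);
* `AbelianVariety.cotangentBaseChangeMap_comp_baseChange_hom_cotangentMap` — on cotangent spaces,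
  `Φ_A ∘ (1 ⊗ f^*) = (f_L)^* ∘ Φ_B`, and the `≃`-forms `cotangentBaseChange_comp_baseChange_hom_cotangentMap`,
  `hom_cotangentMap_baseChange_eq_conj` (`(f_L)^* = Φ_A ∘ (1 ⊗ f^*) ∘ Φ_B⁻¹`);
* **`AbelianVariety.Hom.cotangentMap_baseChange_eq_zero_iff`** — `(f_L)^* = 0 ↔ f^* = 0`: the
  vanishing of the (co)tangent map of a homomorphism descends along, and is stable under, base
  field extension (Görtz–Wedhorn I, Remark 6.12 (2)–(3) with Prop. B.14 (faithful flatness of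
  `K → L` on vector spaces); Shimura 1998, §13.1 p. 129 uses `δλ̃ = 0` after passing to a
  bigger field).

This is the hom-version of the endomorphism-only naturality of
`Motives/AbelianVarietyCotangentBaseChange(Iso)` (`stalkMapFst_comp_stalkMapEnd_baseChange`,
`cotangentBaseChangeMap_comp_baseChange_cotangentMap`, `cotangentMap_baseChange_eq_conj`), with the
same proofs. Everything is proved; no named facts; no definitions.

## Design notes

* No local instances are needed here: the `K`-structures on `𝒪_{A_L,e}` and `T_e^*(A_L)`
  (`stalkOriginAlgebraOfBase`, `Cotangent.moduleOfBase` of `Motives/AbelianVarietyCotangentBaseChange`)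
  enter only through the statements of the lemmas `cotangentToBaseChange_mk` /
  `cotangentBaseChangeMap_tmul` used in the proofs; every statement below is about `L`-linear maps.
* Mathlib searched and used: `TensorProduct.induction_on`, `LinearMap.baseChange_tmul`,
  `LinearMap.baseChange_zero`, `LinearEquiv` cancellation lemmas, and
  `Module.Flat.tensorProduct_mk_injective` (`w ↦ 1 ⊗ w : W → L ⊗_K W` is injective) for
  `baseChange_eq_zero_iff`; Mathlib's `Module.FaithfullyFlat.zero_iff_lTensor_zero` is the
  `lTensor` form of the same statement.

## References

* [GortzWedhorn2020] U. Görtz, T. Wedhorn, *Algebraic Geometry I* (2nd ed., 2020): Remark 6.3 (3),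
  Remark 6.12 (2)–(3), (6.6.2)–(6.6.3) (p. 188).
* [Shimura1998] G. Shimura, *Abelian Varieties with Complex Multiplication and Modular Functions*
  (1998), §13.1 (p. 129).
-/

universe u

open CategoryTheory CategoryTheory.Limits AlgebraicGeometry IsLocalRing TensorProduct

noncomputable section

namespace Literature.AlgebraicGeometry.Motives

namespace AbelianVariety

open scoped MonObj
open AlgPoints

variable {K : Type u} [Field K] (L : Type u) [Field L] [Algebra K L] {A B : AbelianVariety K}

/-! ### Local rings at the origins -/

/-- Functoriality of points at the origin in a homomorphism `f : A → B`: `Spec R → A —f→ B` is the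
point of `f^* ≫ g` (the endomorphism case is `ptOfStalkHom_comp_toSchemeHom`).
[cite: GortzWedhorn2020, Remark 6.3 (3)] -/
theorem Hom.ptOfStalkHom_comp_toSchemeHom {R : CommRingCat.{u}} (g : stalkOrigin A ⟶ R)
    (f : A ⟶ B) :
    ptOfStalkHom g ≫ Hom.toSchemeHom f = ptOfStalkHom (Hom.stalkMapOrigin f ≫ g) := by
  rw [ptOfStalkHom, ptOfStalkHom, Hom.stalkMapOrigin, Category.assoc,
    ← Scheme.SpecMap_stalkMap_fromSpecStalk, TopCat.Presheaf.stalkCongr_inv,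
    ← Scheme.SpecMap_stalkSpecializes_fromSpecStalk (specializes_of_eq (toSchemeHom_origin f)),
    Spec.map_comp, Spec.map_comp, Category.assoc, Category.assoc]

/-- **`pr^*` intertwines `f^*` and `(f_L)^*`:** `(f_L)^* ∘ pr_B^* = pr_A^* ∘ f^*` on `𝒪_{B,e}`
(from `f_L ≫ pr_B = pr_A ≫ f`, `toSchemeHom_baseChange_comp_bcFst`; the endomorphism case is
`stalkMapFst_comp_stalkMapEnd_baseChange`).
[cite: GortzWedhorn2020, Remark 6.3 (3) and Remark 6.12 (2)–(3), (6.6.2)–(6.6.3) (p. 188)] -/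
theorem stalkMapFst_comp_stalkMapOrigin_baseChange (f : A ⟶ B) :
    stalkMapFst L B ≫ Hom.stalkMapOrigin (Hom.baseChange L f) =
      Hom.stalkMapOrigin f ≫ stalkMapFst L A := by
  haveI := Hom.isLocalHom_stalkMapOrigin f
  haveI := Hom.isLocalHom_stalkMapOrigin (Hom.baseChange L f)
  haveI : IsLocalHom
      (CommRingCat.Hom.hom (stalkMapFst L B ≫ Hom.stalkMapOrigin (Hom.baseChange L f))) := by
    rw [CommRingCat.hom_comp]; infer_instance
  haveI : IsLocalHom (CommRingCat.Hom.hom (Hom.stalkMapOrigin f ≫ stalkMapFst L A)) := by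
    rw [CommRingCat.hom_comp]; infer_instance
  haveI : IsLocalHom (CommRingCat.Hom.hom (𝟙 (stalkOrigin (A.baseChange L)))) := by
    rw [CommRingCat.hom_id]; infer_instance
  apply eq_of_ptOfStalkHom_eq
  have e1 : ptOfStalkHom (stalkMapFst L B ≫ Hom.stalkMapOrigin (Hom.baseChange L f)) =
      ptOfStalkHom (𝟙 (stalkOrigin (A.baseChange L))) ≫
        Hom.toSchemeHom (Hom.baseChange L f) ≫ bcFst L B := by
    rw [← Category.assoc, Hom.ptOfStalkHom_comp_toSchemeHom, Category.comp_id,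
      ptOfStalkHom_comp_bcFst]
  have e2 : ptOfStalkHom (Hom.stalkMapOrigin f ≫ stalkMapFst L A) =
      ptOfStalkHom (𝟙 (stalkOrigin (A.baseChange L))) ≫ bcFst L A ≫ Hom.toSchemeHom f := by
    rw [← Category.assoc, ptOfStalkHom_comp_bcFst, Category.comp_id,
      Hom.ptOfStalkHom_comp_toSchemeHom]
  rw [e1, e2, toSchemeHom_baseChange_comp_bcFst]

/-- Pointwise form of `stalkMapFst_comp_stalkMapOrigin_baseChange`.
[cite: GortzWedhorn2020, Remark 6.3 (3) and Remark 6.12 (2)–(3), (6.6.2)–(6.6.3) (p. 188)] -/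
theorem Hom.stalkMapOrigin_baseChange_stalkMapFst (f : A ⟶ B) (b : stalkOrigin B) :
    Hom.stalkMapOrigin (Hom.baseChange L f) (stalkMapFst L B b) =
      stalkMapFst L A (Hom.stalkMapOrigin f b) := by
  rw [← CommRingCat.comp_apply, stalkMapFst_comp_stalkMapOrigin_baseChange, CommRingCat.comp_apply]

/-! ### Cotangent spaces -/

/-- **Naturality of the base-change map in the homomorphism:**
`Φ_A ∘ (1 ⊗ f^*) = (f_L)^* ∘ Φ_B` (`(f_L)^* ∘ pr_B^* = pr_A^* ∘ f^*`; the endomorphism case is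
`cotangentBaseChangeMap_comp_baseChange_cotangentMap`).
[cite: GortzWedhorn2020, Remark 6.3 (3) and Remark 6.12 (2)–(3), (6.6.2)–(6.6.3) (p. 188)] -/
theorem cotangentBaseChangeMap_comp_baseChange_hom_cotangentMap (f : A ⟶ B) :
    cotangentBaseChangeMap L A ∘ₗ (Hom.cotangentMap f).baseChange L =
      Hom.cotangentMap (Hom.baseChange L f) ∘ₗ cotangentBaseChangeMap L B := by
  apply LinearMap.ext
  intro t
  induction t using TensorProduct.induction_on with
  | zero => simp only [map_zero]
  | add x y hx hy => simp only [map_add, hx, hy]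
  | tmul c v =>
    obtain ⟨x, rfl⟩ := Cotangent.mk_surjective v
    simp only [LinearMap.comp_apply, LinearMap.baseChange_tmul, cotangentBaseChangeMap_tmul,
      Hom.cotangentMap_mk, cotangentToBaseChange_mk, _root_.map_smul]
    have key : ∀ p q, (⟨stalkMapFst L A (Hom.stalkMapOrigin f x), p⟩ :
        ↥(maximalIdeal (stalkOrigin (A.baseChange L)))) =
          ⟨Hom.stalkMapOrigin (Hom.baseChange L f) (stalkMapFst L B x), q⟩ :=
      fun p q => Subtype.ext (Hom.stalkMapOrigin_baseChange_stalkMapFst L f x).symm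
    rw [key]

/-- **Naturality, `≃`-form:** `(f_L)^* ∘ (L ⊗ T_e^*(B) ≃ T_e^*(B_L)) = (L ⊗ T_e^*(A) ≃ T_e^*(A_L)) ∘ (1 ⊗ f^*)`.
[cite: GortzWedhorn2020, Remark 6.3 (3) and Remark 6.12 (2)–(3), (6.6.2)–(6.6.3) (p. 188)] -/
theorem cotangentBaseChange_comp_baseChange_hom_cotangentMap (f : A ⟶ B) :
    (cotangentBaseChange L A).toLinearMap ∘ₗ (Hom.cotangentMap f).baseChange L =
      Hom.cotangentMap (Hom.baseChange L f) ∘ₗ (cotangentBaseChange L B).toLinearMap :=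
  cotangentBaseChangeMap_comp_baseChange_hom_cotangentMap L f

/-- Pointwise naturality: `e_A ((1 ⊗ f^*) t) = (f_L)^* (e_B t)`.
[cite: GortzWedhorn2020, Remark 6.3 (3) and Remark 6.12 (2)–(3), (6.6.2)–(6.6.3) (p. 188)] -/
theorem cotangentBaseChange_baseChange_hom_apply (f : A ⟶ B) (t : L ⊗[K] Cotangent B) :
    cotangentBaseChange L A ((Hom.cotangentMap f).baseChange L t) =
      Hom.cotangentMap (Hom.baseChange L f) (cotangentBaseChange L B t) :=
  LinearMap.congr_fun (cotangentBaseChange_comp_baseChange_hom_cotangentMap L f) t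

/-- **`(f_L)^*` is the base change of `f^*`**, transported along the two isomorphisms:
`(f_L)^* = e_A ∘ (1 ⊗ f^*) ∘ e_B⁻¹` (the endomorphism case is `cotangentMap_baseChange_eq_conj`).
[cite: GortzWedhorn2020, Remark 6.3 (3) and Remark 6.12 (2)–(3), (6.6.2)–(6.6.3) (p. 188)] -/
theorem hom_cotangentMap_baseChange_eq_conj (f : A ⟶ B) :
    Hom.cotangentMap (Hom.baseChange L f) =
      (cotangentBaseChange L A).toLinearMap ∘ₗ (Hom.cotangentMap f).baseChange L ∘ₗ
        (cotangentBaseChange L B).symm.toLinearMap := by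
  apply LinearMap.ext
  intro w
  have h := LinearMap.congr_fun (cotangentBaseChange_comp_baseChange_hom_cotangentMap L f)
    ((cotangentBaseChange L B).symm w)
  simp only [LinearMap.comp_apply, LinearEquiv.coe_toLinearMap, LinearEquiv.apply_symm_apply] at h ⊢
  exact h.symm

/-- Base change of `K`-linear maps along a field extension reflects and preserves vanishing:
`1_L ⊗ φ = 0 ↔ φ = 0` (faithful flatness of `K → L`; Görtz–Wedhorn I, Prop. B.14 / Remark 6.12).
[cite: GortzWedhorn2020, Remark 6.12 (2)–(3) (p. 188)] -/
theorem baseChange_eq_zero_iff {V W : Type*} [AddCommGroup V] [Module K V] [AddCommGroup W]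
    [Module K W] (φ : V →ₗ[K] W) : φ.baseChange L = 0 ↔ φ = 0 := by
  refine ⟨fun h => ?_, fun h => by rw [h, LinearMap.baseChange_zero]⟩
  ext v
  apply Module.Flat.tensorProduct_mk_injective K W L
  change (1 : L) ⊗ₜ[K] φ v = (1 : L) ⊗ₜ[K] (0 : W)
  rw [TensorProduct.tmul_zero, ← LinearMap.baseChange_tmul, h, LinearMap.zero_apply]

/-- **`(f_L)^* = 0 ↔ f^* = 0`**: the cotangent (equivalently tangent) map of a homomorphism vanishes
iff it vanishes after base change to a bigger field (Görtz–Wedhorn I, Remark 6.12 (2)–(3):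
`T_{e}(A_L) = T_e(A) ⊗_K L` functorially; `K → L` faithfully flat). This is the descent step of the
height-one road: Shimura (1998), §13.1 p. 129, computes `δλ̃` over a field big enough to split the
CM algebra. [cite: GortzWedhorn2020, Remark 6.12 (2)–(3), (6.6.2)–(6.6.3) (p. 188)]
[cite: Shimura1998, §13.1 (p. 129)] -/
theorem Hom.cotangentMap_baseChange_eq_zero_iff (f : A ⟶ B) :
    Hom.cotangentMap (Hom.baseChange L f) = 0 ↔ Hom.cotangentMap f = 0 := by
  rw [hom_cotangentMap_baseChange_eq_conj, ← baseChange_eq_zero_iff L (Hom.cotangentMap f)]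
  constructor
  · intro h
    have h' := congrArg (fun ψ => (cotangentBaseChange L A).symm.toLinearMap ∘ₗ ψ ∘ₗ
      (cotangentBaseChange L B).toLinearMap) h
    simpa [LinearMap.comp_assoc, LinearEquiv.symm_comp, LinearEquiv.comp_symm] using h'
  · intro h
    rw [h, LinearMap.zero_comp, LinearMap.comp_zero]

end AbelianVariety

end Literature.AlgebraicGeometry.Motives
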